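import Literature.AnabelianGeometry.SemiGraphs.TreeSystemFixedCrossings
import Literature.AnabelianGeometry.SemiGraphs.TreeSystemFixedPoint
import Literature.AnabelianGeometry.SemiGraphs.TemperedLevelData
import HarnessLib

/-!
# (FIX∞), second clause, without boundedness: adjacency from vertical finiteness of the fixed loci
([SemiAnbd] Thm. 3.7 (iii), p. 41)

Mochizuki, *Semi-graphs of anabelioids*, Publ. RIMS **42** (2006), Thm. 3.7 (iii), p. 41, with the
author's *Comments* (2020) (6). [cite: MochizukiSemiAnbd2006, Thm. 3.7(iii) p.41]

PROOF-ONLY assembly (cell abc-iut, layer L3; GAP row G-t6g3-2b, sub-row G2·E2-unbounded «vertical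
branch», rulings α33/α47; seat abc-iut-w5-d160; no definition).  `TreeSystemBoundedGeodesics.lean`
proved the second clause `hadj` of the fixed-systems input (FIX∞) — two compatible `C`-fixed vertex
systems are, level by level, equal or joined by a `C`-fixed edge — under the hypothesis that their level
distances are BOUNDED.  Here the boundedness is removed, for tree systems with finite stars, modulo ONE
finiteness binder on the fixed loci:

* `SemiGraph.adjacent_of_noFixedBranchPairSystem_of_finite_fixedFibres` — `C ≠ 1` fixing no compatible
  system of branch-pairs (the tree-level estrangement input, discharged in the cell by abc-iut-w4-d080's
  `noFixedTreeBranchPairSystem_of_stabBranchPairCpt`), finite stars, and «VERTICAL FINITENESS» at a cofinal set of base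
  levels: over each vertex of such a level only finitely many `C`-FIXED vertices of any higher level ⇒ for all compatible
  `C`-fixed `x`, `x'` and every level with `x j ≠ x' j`, the two are joined by a `C`-fixed edge;
* `ProfiniteSemiGraph.VerticialLevelData.hadj_of_finite_fixedFibres` — the same over the level data of a
  chart (`TemperedLevelData.lean`), in the binder shape of the cell's (FIX∞).`hadj`.

Route: if the level-`j` geodesic has `≥ 2` edges, the crossing lemma
(`exists_fixedSubjoint_lastDeparture`, `TreeSystemFixedCrossings.lean`) gives at every level `K ≥ j` a
`C`-fixed subjoint over the first interior vertex `u` with first branch over the geodesic branch `β₁` and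
second branch over SOME other branch at `u`; by finiteness of the star of `u` one exit branch `β ≠ β₁`
serves cofinally many levels (`exists_cofinal_fibre_of_finite`); a Kőnig selection over the base
subjoint `(u; β₁, β)` (in substance abc-iut-w5-d189's `SemiGraph.exists_fixedSubjointSystem_over_of_cofinal`
of `TreeSystemSubjointSelection.lean` with base `:= T j`, structure maps `:= f`; re-derived below as the
private `exists_system_over` from abc-iut-L3-t6's unbundled Kőnig `SemiGraph.exists_compatible_of_finite`
so that this file imports built modules only) then yields a COMPATIBLE `C`-fixed subjoint system above
`j`, which the estrangement input kills — so the geodesic has one edge,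
fixed by `C` (Lem. 1.8 (ii)(b)).  HONEST RESIDUAL: the vertical-finiteness binder (at the canonical tower
of a semi-graph of anabelioids it follows from «no `C`-fixed cycle of a finite level graph», abc-iut-L3-d1;
TRUE at abc-iut-w4-d075's `𝒢⋆`, where moreover the whole statement is vacuous — one compatible fixed
system); finite stars FAIL at `𝒢⋆` (infinite valence) — there `hadj` is vacuous anyway.
-/

namespace Literature.AnabelianGeometry.SemiGraphs

namespace SemiGraph

open CategoryTheory

universe v u

variable {P : Type u} [Group P] {J : Type v} [Preorder J]

/-- Kőnig selection of a compatible `C`-fixed subjoint system over a fixed base subjoint `(u; b, b')`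
of `T i` from cofinally many levels `≥ i`, given finite `C`-fixed vertex fibres over `u` and finite stars
(in substance abc-iut-w5-d189's `exists_fixedSubjointSystem_over_of_cofinal`, base `:= T i`; here from
abc-iut-L3-t6's `exists_compatible_of_finite`). [cite: MochizukiSemiAnbd2006, Thm. 3.7(iii) p.41] -/
private theorem exists_system_over [IsDirectedOrder J]
    (C : Subgroup P) (T : J → SemiGraph.{u}) (ρ : ∀ j, P →* Aut (T j))
    (f : ∀ ⦃i j : J⦄, i ≤ j → (T j ⟶ T i))
    (hid : ∀ j, f (le_refl j) = 𝟙 (T j))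
    (hcomp : ∀ ⦃i j k : J⦄ (hij : i ≤ j) (hjk : j ≤ k), f hjk ≫ f hij = f (hij.trans hjk))
    (hequiv : ∀ ⦃i j : J⦄ (h : i ≤ j) (g : P), (ρ j g).hom ≫ f h = f h ≫ (ρ i g).hom)
    (i : J) (u : (T i).Vertex) (b b' : (T i).Branch) (hbb' : b ≠ b')
    (hcof : ∀ K : {K : J // i ≤ K}, ∃ (K' : {K : J // i ≤ K}), K ≤ K' ∧
      ∃ (w : (T K'.1).Vertex) (β β' : (T K'.1).Branch), (f K'.2).vertexMap w = u ∧
        (f K'.2).branchMap β = b ∧ (f K'.2).branchMap β' = b' ∧ (T K'.1).abuts β = some w ∧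
        (T K'.1).abuts β' = some w ∧ ∀ γ : C, (ρ K'.1 γ).hom.vertexMap w = w ∧
          (ρ K'.1 γ).hom.branchMap β = β ∧ (ρ K'.1 γ).hom.branchMap β' = β')
    (hfinV : ∀ K : {K : J // i ≤ K}, {w : (T K.1).Vertex | (f K.2).vertexMap w = u ∧
      ∀ γ : C, (ρ K.1 γ).hom.vertexMap w = w}.Finite)
    (hstar : ∀ (K : {K : J // i ≤ K}) (w : (T K.1).Vertex), Finite ((T K.1).Star w)) :
    ∃ (m : ∀ K : {K : J // i ≤ K}, (T K.1).Vertex) (δ δ' : ∀ K : {K : J // i ≤ K}, (T K.1).Branch),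
      (∀ K, δ K ≠ δ' K ∧ (T K.1).abuts (δ K) = some (m K) ∧ (T K.1).abuts (δ' K) = some (m K)) ∧
      (∀ ⦃K K' : {K : J // i ≤ K}⦄ (h : K.1 ≤ K'.1), (f h).vertexMap (m K') = m K ∧
        (f h).branchMap (δ K') = δ K ∧ (f h).branchMap (δ' K') = δ' K) ∧
      (∀ (K : {K : J // i ≤ K}) (γ : C), (ρ K.1 γ).hom.vertexMap (m K) = m K ∧
        (ρ K.1 γ).hom.branchMap (δ K) = δ K ∧ (ρ K.1 γ).hom.branchMap (δ' K) = δ' K) := by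
  classical
  let S := {K : J // i ≤ K}
  haveI : IsDirectedOrder S := by
    refine ⟨fun a c => ?_⟩
    obtain ⟨d, had, hcd⟩ := exists_ge_ge a.1 c.1
    exact ⟨⟨d, a.2.trans had⟩, had, hcd⟩
  -- the family of `C`-fixed subjoints over `(u; b, b')`
  let A : ∀ K : S, Set ((T K.1).Vertex × (T K.1).Branch × (T K.1).Branch) := fun K =>
    {p | (f K.2).vertexMap p.1 = u ∧ (f K.2).branchMap p.2.1 = b ∧ (f K.2).branchMap p.2.2 = b' ∧
      (T K.1).abuts p.2.1 = some p.1 ∧ (T K.1).abuts p.2.2 = some p.1 ∧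
      ∀ γ : C, (ρ K.1 γ).hom.vertexMap p.1 = p.1 ∧ (ρ K.1 γ).hom.branchMap p.2.1 = p.2.1 ∧
        (ρ K.1 γ).hom.branchMap p.2.2 = p.2.2}
  -- transition maps on triples
  let F : ∀ ⦃K K' : S⦄, K ≤ K' → (T K'.1).Vertex × (T K'.1).Branch × (T K'.1).Branch →
      (T K.1).Vertex × (T K.1).Branch × (T K.1).Branch :=
    fun K K' h p => ((f h).vertexMap p.1, (f h).branchMap p.2.1, (f h).branchMap p.2.2)
  have F_id : ∀ (K : S) (p : (T K.1).Vertex × (T K.1).Branch × (T K.1).Branch), F le_rfl p = p := by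
    intro K p
    have h1 := hid K.1
    show ((f (le_refl K.1)).vertexMap p.1, (f (le_refl K.1)).branchMap p.2.1,
      (f (le_refl K.1)).branchMap p.2.2) = p
    rw [h1]
    rfl
  have F_comp : ∀ ⦃K K' K'' : S⦄ (h : K ≤ K') (h' : K' ≤ K'')
      (p : (T K''.1).Vertex × (T K''.1).Branch × (T K''.1).Branch), F h (F h' p) = F (h.trans h') p := by
    intro K K' K'' h h' p
    have h1 := hcomp (show K.1 ≤ K'.1 from h) (show K'.1 ≤ K''.1 from h')
    show ((f h).vertexMap ((f h').vertexMap p.1), (f h).branchMap ((f h').branchMap p.2.1),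
      (f h).branchMap ((f h').branchMap p.2.2)) =
      ((f (le_trans h h')).vertexMap p.1, (f (le_trans h h')).branchMap p.2.1,
        (f (le_trans h h')).branchMap p.2.2)
    rw [← h1]
    rfl
  -- over `T i` and equivariant: the family is trans-stable
  have hover : ∀ ⦃K K' : S⦄ (h : K ≤ K') (w : (T K'.1).Vertex),
      (f K.2).vertexMap ((f h).vertexMap w) = (f K'.2).vertexMap w := fun K K' h w => by
    have e := congrArg (fun φ => SemiGraph.Hom.vertexMap φ w) (hcomp K.2 (show K.1 ≤ K'.1 from h))
    simpa only [SemiGraph.comp_vertexMap, Function.comp_apply] using e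
  have hoverB : ∀ ⦃K K' : S⦄ (h : K ≤ K') (β : (T K'.1).Branch),
      (f K.2).branchMap ((f h).branchMap β) = (f K'.2).branchMap β := fun K K' h β => by
    have e := congrArg (fun φ => SemiGraph.Hom.branchMap φ β) (hcomp K.2 (show K.1 ≤ K'.1 from h))
    simpa only [SemiGraph.comp_branchMap, Function.comp_apply] using e
  have hequivV : ∀ ⦃K K' : S⦄ (h : K ≤ K') (g : P) (w : (T K'.1).Vertex),
      (f h).vertexMap ((ρ K'.1 g).hom.vertexMap w) = (ρ K.1 g).hom.vertexMap ((f h).vertexMap w) :=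
    fun K K' h g w => by
      have e := congrArg (fun φ => SemiGraph.Hom.vertexMap φ w) (hequiv (show K.1 ≤ K'.1 from h) g)
      simpa only [SemiGraph.comp_vertexMap, Function.comp_apply] using e
  have hequivB : ∀ ⦃K K' : S⦄ (h : K ≤ K') (g : P) (β : (T K'.1).Branch),
      (f h).branchMap ((ρ K'.1 g).hom.branchMap β) = (ρ K.1 g).hom.branchMap ((f h).branchMap β) :=
    fun K K' h g β => by
      have e := congrArg (fun φ => SemiGraph.Hom.branchMap φ β) (hequiv (show K.1 ≤ K'.1 from h) g)
      simpa only [SemiGraph.comp_branchMap, Function.comp_apply] using e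
  have hmap : ∀ ⦃K K' : S⦄ (h : K ≤ K'), ∀ p ∈ A K', F h p ∈ A K := by
    rintro K K' h p ⟨hu, hb, hb', ha, ha', hfix⟩
    refine ⟨by rw [hover h, hu], by rw [hoverB h, hb], by rw [hoverB h, hb'],
      (f h).abuts_branchMap _ _ ha, (f h).abuts_branchMap _ _ ha', fun γ => ⟨?_, ?_, ?_⟩⟩
    · show (ρ K.1 γ).hom.vertexMap ((f h).vertexMap p.1) = (f h).vertexMap p.1
      rw [← hequivV h, (hfix γ).1]
    · show (ρ K.1 γ).hom.branchMap ((f h).branchMap p.2.1) = (f h).branchMap p.2.1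
      rw [← hequivB h, (hfix γ).2.1]
    · show (ρ K.1 γ).hom.branchMap ((f h).branchMap p.2.2) = (f h).branchMap p.2.2
      rw [← hequivB h, (hfix γ).2.2]
  have hAne : ∀ K : S, (A K).Nonempty := by
    intro K
    obtain ⟨K', hKK', w, β, β', hw, hβ, hβ', ha, ha', hfix⟩ := hcof K
    exact ⟨F hKK' (w, β, β'), hmap hKK' (w, β, β') ⟨hw, hβ, hβ', ha, ha', hfix⟩⟩
  have hAfin : ∀ K : S, (A K).Finite := by
    intro K
    let V : Set (T K.1).Vertex := {w | (f K.2).vertexMap w = u ∧ ∀ γ : C, (ρ K.1 γ).hom.vertexMap w = w}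
    let W : Set (T K.1).Branch := ⋃ w ∈ V, {β : (T K.1).Branch | (T K.1).abuts β = some w}
    have hV : V.Finite := hfinV K
    have hW : W.Finite := hV.biUnion fun w _ => by
      haveI := hstar K w
      exact (Set.finite_range (fun β : (T K.1).Star w => (β : (T K.1).Branch))).subset
        fun β hβ => ⟨⟨β, hβ⟩, rfl⟩
    refine (hV.prod (hW.prod hW)).subset ?_
    rintro ⟨w, β, β'⟩ ⟨hw, -, -, ha, ha', hfix⟩
    have hwV : w ∈ V := ⟨hw, fun γ => (hfix γ).1⟩
    exact ⟨hwV, Set.mem_biUnion hwV ha, Set.mem_biUnion hwV ha'⟩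
  obtain ⟨x, hxA, hxc⟩ := exists_compatible_of_finite F F_id F_comp A hAfin hAne
    (fun K K' h p hp => hmap h p hp)
  refine ⟨fun K => (x K).1, fun K => (x K).2.1, fun K => (x K).2.2, fun K => ?_, fun K K' h => ?_,
    fun K γ => (hxA K).2.2.2.2.2 γ⟩
  · obtain ⟨-, hb, hb', ha, ha', -⟩ := hxA K
    refine ⟨fun heq => hbb' ?_, ha, ha'⟩
    have h' : (x K).2.1 = (x K).2.2 := heq
    rw [← hb, ← hb', h']
  · have hc := hxc (show K ≤ K' from h)
    exact ⟨congrArg Prod.fst hc, congrArg (fun p => p.2.1) hc, congrArg (fun p => p.2.2) hc⟩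

/-- **(FIX∞), second clause, from vertical finiteness.**  Let `C ≠ 1` act on a directed system of trees
with functorial, equivariant transition morphisms, fixing no compatible system of branch-pairs above any
level; assume the trees have finite stars and that, cofinally in the base level `i'`, over every vertex of
`T i'` only finitely many `C`-fixed vertices of any higher level lie (at low levels `C` may act trivially,
so only an eventual / cofinal form of this «vertical finiteness» can hold).  Then two compatible systems `x`, `x'` of `C`-fixed vertices
are, at every level with `x j ≠ x' j`, joined by an edge fixed by `C`.
[cite: MochizukiSemiAnbd2006, Thm. 3.7(iii) p.41] -/
theorem adjacent_of_noFixedBranchPairSystem_of_finite_fixedFibres [IsDirectedOrder J]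
    (C : Subgroup P) (T : J → SemiGraph.{u}) (hT : ∀ j, (T j).IsTree) (ρ : ∀ j, P →* Aut (T j))
    (f : ∀ ⦃i j : J⦄, i ≤ j → (T j ⟶ T i))
    (hid : ∀ j, f (le_refl j) = 𝟙 (T j))
    (hcomp : ∀ ⦃i j k : J⦄ (hij : i ≤ j) (hjk : j ≤ k), f hjk ≫ f hij = f (hij.trans hjk))
    (hequiv : ∀ ⦃i j : J⦄ (h : i ≤ j) (g : P), (ρ j g).hom ≫ f h = f h ≫ (ρ i g).hom)
    (hnobp : ∀ (j₀ : J) (w : ∀ i : {i : J // j₀ ≤ i}, (T i.1).Vertex)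
      (β β' : ∀ i : {i : J // j₀ ≤ i}, (T i.1).Branch),
      (∀ i, β i ≠ β' i ∧ (T i.1).abuts (β i) = some (w i) ∧ (T i.1).abuts (β' i) = some (w i)) →
      (∀ ⦃i i' : {i : J // j₀ ≤ i}⦄ (h : i.1 ≤ i'.1), (f h).vertexMap (w i') = w i ∧
        (f h).branchMap (β i') = β i ∧ (f h).branchMap (β' i') = β' i) →
      (∀ (i : {i : J // j₀ ≤ i}) (γ : C), (ρ i.1 γ).hom.vertexMap (w i) = w i ∧
        (ρ i.1 γ).hom.branchMap (β i) = β i ∧ (ρ i.1 γ).hom.branchMap (β' i) = β' i) → C = ⊥)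
    (hC : C ≠ ⊥)
    (hstar : ∀ (j : J) (w : (T j).Vertex), Finite ((T j).Star w))
    (hfinV : ∀ i : J, ∃ i' : J, i ≤ i' ∧ ∀ (K : J) (h : i' ≤ K) (u : (T i').Vertex),
      {y : (T K).Vertex | (f h).vertexMap y = u ∧ ∀ γ : C, (ρ K γ).hom.vertexMap y = y}.Finite)
    (x x' : ∀ j, (T j).Vertex)
    (hx : ∀ ⦃i j : J⦄ (h : i ≤ j), (f h).vertexMap (x j) = x i)
    (hx' : ∀ ⦃i j : J⦄ (h : i ≤ j), (f h).vertexMap (x' j) = x' i)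
    (hfx : ∀ (j : J) (γ : C), (ρ j γ).hom.vertexMap (x j) = x j)
    (hfx' : ∀ (j : J) (γ : C), (ρ j γ).hom.vertexMap (x' j) = x' j)
    (j : J) (hne : x j ≠ x' j) :
    ∃ (e : (T j).Edge) (b b' : (T j).Branch), b ≠ b' ∧ (T j).edgeOf b = e ∧ (T j).edgeOf b' = e ∧
      (T j).abuts b = some (x j) ∧ (T j).abuts b' = some (x' j) ∧
      ∀ γ : C, (ρ j γ).hom.edgeMap e = e := by
  classical
  -- STEP 1: at a «vertically finite» base level `i' ≥ j`, the geodesic has exactly one edge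
  obtain ⟨i', hji', hfin'⟩ := hfinV j
  have hne' : x i' ≠ x' i' := fun h => hne (by rw [← hx hji', ← hx' hji', h])
  have hA' : (T i').subdivision.IsAcyclic := (hT i').isTree.isAcyclic
  obtain ⟨p', hp'⟩ :=
    (hT i').isTree.connected.exists_walk_length_eq_dist (Sum.inl (x i')) (Sum.inl (x' i'))
  have hpath' : p'.IsPath := p'.isPath_of_length_eq_dist hp'
  obtain ⟨h4le', c₁, β₁, e₁, u, -, -, hβ₁e, -, hβ₁u, -, hx2, hx3, hx4⟩ := path_inl_prefix hne' p' hpath'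
  have hlen' : p'.length = 4 := by
    by_contra hne4
    have h4 : 4 < p'.length := lt_of_le_of_ne h4le' (Ne.symm hne4)
    -- `≥ 2` edges: crossings over `u` at every higher level, one exit branch cofinally, Kőnig, kill
    let S := {K : J // i' ≤ K}
    haveI : IsDirectedOrder S := by
      refine ⟨fun a c => ?_⟩
      obtain ⟨d, had, hcd⟩ := exists_ge_ge a.1 c.1
      exact ⟨⟨d, a.2.trans had⟩, had, hcd⟩
    have hcross : ∀ K : S, ∃ (y : (T K.1).Vertex) (δ₁ δ : (T K.1).Branch), δ₁ ≠ δ ∧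
        (T K.1).abuts δ₁ = some y ∧ (T K.1).abuts δ = some y ∧ (f K.2).vertexMap y = u ∧
        (f K.2).branchMap δ₁ = β₁ ∧ (f K.2).branchMap δ ≠ β₁ ∧
        (T i').abuts ((f K.2).branchMap δ) = some u ∧
        ∀ γ : C, (ρ K.1 γ).hom.vertexMap y = y ∧ (ρ K.1 γ).hom.branchMap δ₁ = δ₁ ∧
          (ρ K.1 γ).hom.branchMap δ = δ :=
      fun K => exists_fixedSubjoint_lastDeparture C T hT ρ f x x' hx hx' hfx hfx' p' hpath' h4 hx2 hx3
        hx4 hβ₁e hβ₁u K.2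
    choose y δ₁ δ hδne hδ₁y hδy hyu hδ₁β hδβ hδu hfixK using hcross
    -- one exit branch `β ≠ β₁` at `u` serves a cofinal set of levels
    haveI : Finite ((T i').Star u) := hstar i' u
    obtain ⟨a, ha⟩ := exists_cofinal_fibre_of_finite (α := (T i').Star u) i'
      (fun K : S => (⟨(f K.2).branchMap (δ K), hδu K⟩ : (T i').Star u))
    obtain ⟨K₁, hK₁, hgK₁⟩ := ha i' (le_refl i')
    have haβ₁ : a.1 ≠ β₁ := by
      have := congrArg Subtype.val hgK₁
      simp only at this
      rw [← this]
      exact hδβ ⟨K₁, (le_refl i').trans hK₁⟩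
    -- Kőnig selection over the base subjoint `(u; β₁, a)` of `T i'`
    obtain ⟨m, ε, ε', hpair, hcompat, hfix⟩ :=
      exists_system_over C T ρ f hid hcomp hequiv i' u β₁ a.1 (Ne.symm haβ₁)
        (fun K => by
          obtain ⟨K', hKK', hg⟩ := ha K.1 K.2
          have hval : (f ((K.2 : i' ≤ K.1).trans hKK')).branchMap (δ ⟨K', K.2.trans hKK'⟩) = a.1 :=
            congrArg Subtype.val hg
          exact ⟨⟨K', K.2.trans hKK'⟩, hKK', y _, δ₁ _, δ _, hyu _, hδ₁β _, hval, hδ₁y _, hδy _,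
            hfixK _⟩)
        (fun K => hfin' K.1 K.2 u) (fun K w => hstar K.1 w)
    exact hC (hnobp i' m ε ε' hpair hcompat hfix)
  -- STEP 2: the distance at level `j` is then at most, hence exactly, one edge — fixed by `C`
  have hA : (T j).subdivision.IsAcyclic := (hT j).isTree.isAcyclic
  obtain ⟨p, hp⟩ := (hT j).isTree.connected.exists_walk_length_eq_dist (Sum.inl (x j)) (Sum.inl (x' j))
  have hpath : p.IsPath := p.isPath_of_length_eq_dist hp
  have hlen : p.length = 4 := by
    have h1 := (path_inl_prefix hne p hpath).1
    have h2 := dist_le_dist_of_compatible T hT f x x' hx hx' hji'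
    omega
  obtain ⟨e, b, b', hbb', hbe, hb'e, hbx, hb'x, hx2'⟩ := joins_of_path_length_four hne p hpath hlen
  refine ⟨e, b, b', hbb', hbe, hb'e, hbx, hb'x, fun γ => ?_⟩
  have hfix := nodeMap_eq_self_of_isPath hA (ρ j γ) (x := Sum.inl (x j)) (y := Sum.inl (x' j))
    (by simp only [nodeMap, Sum.map_inl, hfx]) (by simp only [nodeMap, Sum.map_inl, hfx']) p hpath
    _ (p.getVert_mem_support 2)
  rw [hx2'] at hfix
  exact Sum.inl_injective (Sum.inr_injective hfix)

end SemiGraph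

namespace ProfiniteSemiGraph

namespace VerticialLevelData

open CategoryTheory

universe v' u'

variable {𝒢 : ProfiniteSemiGraph.{u'}} {c : TemperedPiChart 𝒢} (D : VerticialLevelData.{v'} 𝒢 c)

/-- **(FIX∞), second clause, over the level data of a chart, from vertical finiteness** ([SemiAnbd]
Thm. 3.7 (iii) beyond finite semi-graphs): for `C ≠ 1` fixing no compatible system of branch-pairs of the
trees `D.tree j` above any level, trees with finite stars, and — for a cofinal set of base levels `i'` —
finitely many `C`-fixed vertices of `D.tree K` over each vertex of `D.tree i'` (`i' ≤ K`), two compatible systems of `C`-fixed vertices are, at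
every level with `x j ≠ x' j`, joined by an edge of `D.tree j` fixed by `C` — with NO boundedness
hypothesis on their distances. [cite: MochizukiSemiAnbd2006, Thm. 3.7(iii) p.41] -/
theorem hadj_of_finite_fixedFibres (C : Subgroup c.G) (hC : C ≠ ⊥)
    (hnobp : ∀ (j₀ : D.J) (w : ∀ i : {i : D.J // j₀ ≤ i}, (D.tree i.1).Vertex)
      (β β' : ∀ i : {i : D.J // j₀ ≤ i}, (D.tree i.1).Branch),
      (∀ i, β i ≠ β' i ∧ (D.tree i.1).abuts (β i) = some (w i) ∧ (D.tree i.1).abuts (β' i) = some (w i)) →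
      (∀ ⦃i i' : {i : D.J // j₀ ≤ i}⦄ (h : i.1 ≤ i'.1), (D.trans h).vertexMap (w i') = w i ∧
        (D.trans h).branchMap (β i') = β i ∧ (D.trans h).branchMap (β' i') = β' i) →
      (∀ (i : {i : D.J // j₀ ≤ i}), ∀ g ∈ C, (D.act i.1 g).hom.vertexMap (w i) = w i ∧
        (D.act i.1 g).hom.branchMap (β i) = β i ∧ (D.act i.1 g).hom.branchMap (β' i) = β' i) → C = ⊥)
    (hstar : ∀ (j : D.J) (w : (D.tree j).Vertex), Finite ((D.tree j).Star w))
    (hfinV : ∀ i : D.J, ∃ i' : D.J, i ≤ i' ∧ ∀ (K : D.J) (h : i' ≤ K) (u : (D.tree i').Vertex),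
      {y : (D.tree K).Vertex | (D.trans h).vertexMap y = u ∧
        ∀ g ∈ C, (D.act K g).hom.vertexMap y = y}.Finite)
    (x x' : ∀ j, (D.tree j).Vertex)
    (hx : ∀ ⦃i j : D.J⦄ (h : i ≤ j), (D.trans h).vertexMap (x j) = x i)
    (hx' : ∀ ⦃i j : D.J⦄ (h : i ≤ j), (D.trans h).vertexMap (x' j) = x' i)
    (hfx : ∀ g ∈ C, ∀ j, (D.act j g).hom.vertexMap (x j) = x j)
    (hfx' : ∀ g ∈ C, ∀ j, (D.act j g).hom.vertexMap (x' j) = x' j)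
    (j : D.J) (hne : x j ≠ x' j) :
    ∃ (e : (D.tree j).Edge) (b b' : (D.tree j).Branch), b ≠ b' ∧
      (D.tree j).edgeOf b = e ∧ (D.tree j).edgeOf b' = e ∧ (D.tree j).abuts b = some (x j) ∧
      (D.tree j).abuts b' = some (x' j) ∧ ∀ g ∈ C, (D.act j g).hom.edgeMap e = e := by
  obtain ⟨e, b, b', hbb', hbe, hb'e, hbx, hb'x, hfix⟩ :=
    SemiGraph.adjacent_of_noFixedBranchPairSystem_of_finite_fixedFibres C D.tree D.isTree D.act D.trans
      D.trans_id D.trans_comp D.trans_act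
      (fun j₀ w β β' h1 h2 h3 => hnobp j₀ w β β' h1 h2 fun i g hg => h3 i ⟨g, hg⟩) hC hstar
      (fun i => by
        obtain ⟨i', hi', h'⟩ := hfinV i
        exact ⟨i', hi', fun K h u => (h' K h u).subset fun y hy => ⟨hy.1, fun g hg => hy.2 ⟨g, hg⟩⟩⟩)
      x x' hx hx'
      (fun j γ => hfx γ.1 γ.2 j) (fun j γ => hfx' γ.1 γ.2 j) j hne
  exact ⟨e, b, b', hbb', hbe, hb'e, hbx, hb'x, fun g hg => hfix ⟨g, hg⟩⟩

end VerticialLevelData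

end ProfiniteSemiGraph

end Literature.AnabelianGeometry.SemiGraphs
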